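import Mathlib
import HarnessLib
import Summits.ResolutionOfSingularities.ResolutionOfSingularities.Theses.WildQuotients
import Summits.ResolutionOfSingularities.ResolutionOfSingularities.Theorems.WildQuotientsWildQuotientResolutionStubQuotientModelNormal
import Summits.ResolutionOfSingularities.ResolutionOfSingularities.Theorems.WildQuotientsWildQuotientResolutionStubBirational
import Summits.ResolutionOfSingularities.ResolutionOfSingularities.Theorems.WildQuotientsWildQuotientResolutionGluedSplitDim
import Summits.ResolutionOfSingularities.ResolutionOfSingularities.Theorems.WildQuotientsWildQuotientResolutionPhaseZeroPClosed
import Summits.ResolutionOfSingularities.ResolutionOfSingularities.Theorems.WildQuotientResolution.Negative.Faithful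
import Literature.AlgebraicGeometry.Ramification.InertiaNormalSylow
import Literature.AlgebraicGeometry.Resolution.ResolutionOfSingularities
import Literature.AlgebraicGeometry.Resolution.ComponentGluing
import Literature.AlgebraicGeometry.Resolution.AlterationsProofs
import Literature.AlgebraicGeometry.Resolution.RegularLocalRingsNormal

/-!
# The glued split `WQ ⇐ PhaseZeroModel ∧ PClosedWQNormal` and `PClosedWQ ⇔ PClosedWQNormal` (crux stmt-ResolutionOfSingularities-15640, line `Sketch`, skeleton v5)

Support for the skeleton `Cruxes/WildQuotientResolution/Lines/Sketch.lean` (v5, lead c3) of the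
crux `WildQuotients.WildQuotientResolution` (WQ). Skeleton v5 SHARPENS the p-closed sub-problem
`stub_pClosedWQ` (crux verbatim + p-closed inertia) into `stub_pClosedWQNormal` (in addition:
`ρ` faithful, `X₁` NORMAL, `dim X₁ > 0` — then `X₁` is the quotient `X′/G` on the nose), paying
with the classical glue `stub_quotientModelNormal` (landed:
`QuotientModelNormal.stub_quotientModelNormal`, the quotient of a normal scheme is normal). This
file certifies, sorry-free, that the reshape lost nothing and that the composition closes:

* `hasNormalSylow_inertiaSubgroup_kerLift` — p-closed inertia passes to the faithful quotient
  action `G ⧸ ker ρ` (inertia of `kerLift ρ` at `x` is the image of the inertia of `ρ`).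
* `pClosedWQ_of_pClosedWQNormal` — **PClosedWQNormal ⇒ PClosedWQ** (registered v4 shape): make
  `ρ` faithful, set dimension `0` apart (regular), pass to the normal quotient `X′/G → X₁`
  (identity Phase-0 model, `PClosedCase.exists_isAffineOpen_stable`; normal because `X′` is
  regular, `isIntegrallyClosed_of_isRegularLocalRing`), which is proper birational by lemma (L),
  resolve it by PClosedWQNormal and descend.
* `pClosedWQNormal_of_pClosedWQ` — the converse (forget the three hypotheses): **PClosedWQ ⇔
  PClosedWQNormal** (`pClosedWQNormal_iff_pClosedWQ`), so every certificate about `stub_pClosedWQ`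
  (`PClosedCase.cyclicWildQuotient_of_pClosedWQ`, `…tameQuotientResolution_of_pClosedWQ`,
  `pClosedWQ_of_resolutionOfSingularities`) transfers verbatim.
* `wildQuotientResolution_of_phaseZero_of_pClosedWQNormal` — **the v5 composition as a theorem**:
  PhaseZeroModel (v5 signature of `stub_phaseZero`, faithful, no engine hypotheses) and
  PClosedWQNormal imply the crux BY NAME.
* Bounded forms for every `d : WithBot ℕ∞` (`pClosedWQ_dimLE_of_pClosedWQNormal_dimLE`,
  `wildQuotientResolution_dimLE_of_phaseZero_of_pClosedWQNormal`, the latter through the landed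
  `GluedSplitDim`, p140132): the first open dimension `d = 4` can be filed as a glued split
  `WQ_{≤4} ⇐ PhaseZeroModel_{≤4} ∧ PClosedWQNormal_{≤4}` with proved glue.

Hypotheses named `hP0` / `hWQn` / `hWQp` below are the registered v5 / v4 stub signatures,
universally closed, verbatim.
-/

-- single-problem summit: the doubled namespace component `ResolutionOfSingularities` is forced
set_option linter.dupNamespace false

noncomputable section

open CategoryTheory AlgebraicGeometry TopologicalSpace
open Literature.AlgebraicGeometry.Resolution Literature.AlgebraicGeometry.Ramification
open Summit.ResolutionOfSingularities.ResolutionOfSingularities.Theses.WildQuotients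

namespace Summit.ResolutionOfSingularities.ResolutionOfSingularities.Theorems.WildQuotientResolution.GluedSplitNormal

/-! ## Inertia of the faithful quotient action -/

/-- **Inertia groups of the faithful quotient action are quotients of inertia groups**: for
`ρ : G →* Aut Y` and the induced FAITHFUL action `QuotientGroup.kerLift ρ` of `G ⧸ ker ρ`, the
inertia group at `y` of the latter is the image of the inertia group of `ρ` at `y`; in particular
it has a normal Sylow `p`-subgroup when `I_y(ρ)` has one (`HasNormalSylow.of_surjective`).
[folklore] -/
theorem hasNormalSylow_inertiaSubgroup_kerLift {p : ℕ} [Fact p.Prime] {G : Type} [Group G]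
    [Finite G] {Y : Scheme.{0}} (ρ : G →* Aut Y) (y : Y)
    (h : HasNormalSylow p (inertiaSubgroup ρ y)) :
    HasNormalSylow p (inertiaSubgroup (QuotientGroup.kerLift ρ) y) := by
  -- the restriction of `G → G ⧸ ker ρ` to the inertia groups
  let φ : inertiaSubgroup ρ y →* inertiaSubgroup (QuotientGroup.kerLift ρ) y :=
    { toFun := fun g => ⟨(g.1 : G ⧸ ρ.ker), by
        rw [mem_inertiaSubgroup_iff, QuotientGroup.kerLift_mk]
        exact g.2⟩
      map_one' := by ext; simp
      map_mul' := fun a b => by ext; simp }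
  refine h.of_surjective φ ?_
  rintro ⟨g, hg⟩
  induction g using QuotientGroup.induction_on with
  | H g =>
    refine ⟨⟨g, ?_⟩, rfl⟩
    rw [mem_inertiaSubgroup_iff] at hg ⊢
    rwa [QuotientGroup.kerLift_mk] at hg

/-! ## Dimension-bounded forms (for bounded companions of the promoted items) -/

/-- **PClosedWQNormal_{≤ d} ⇒ PClosedWQ_{≤ d}** for every `d : WithBot ℕ∞`: the bounded form of
`pClosedWQ_of_pClosedWQNormal` (same proof; the quotient `X′/G → X₁` is birational, hence of the
same dimension, `GluedSplitDim.topologicalKrullDim_eq_of_isBirational`). [folklore] -/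
theorem pClosedWQ_dimLE_of_pClosedWQNormal_dimLE (d : WithBot ℕ∞)
    (hWQn : ∀ (p : ℕ) (_ : p.Prime) (k : Type) [Field k] [CharP k p] (X' X₁ : Scheme.{0})
      (f : X₁ ⟶ Spec (.of k)) (q : X' ⟶ X₁) (G : Type) [Group G] [Finite G] (ρ : G →* Aut X'),
      Function.Injective ρ → IsSeparated f → LocallyOfFiniteType f → QuasiCompact f →
      IsIntegral X₁ → (∀ x : X₁, IsIntegrallyClosed (X₁.presheaf.stalk x)) →
      ¬ topologicalKrullDim X₁ ≤ 0 → IsIntegral X' → Scheme.IsRegular X' → IsFinite q →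
      Function.Surjective q.base → (∃ U : X₁.Opens, Dense (U : Set X₁) ∧ Etale (q ∣_ U)) →
      (∀ g : G, (ρ g).hom ≫ q = q) →
      (∀ x y : X', q.base x = q.base y → ∃ g : G, (ρ g).hom.base x = y) →
      (∀ x : X', HasNormalSylow p (inertiaSubgroup ρ x)) → topologicalKrullDim X₁ ≤ d →
      Scheme.HasResolution X₁)
    (p : ℕ) (hp : p.Prime) (k : Type) [Field k] [CharP k p]
    (X' X₁ : Scheme.{0}) (f : X₁ ⟶ Spec (.of k)) (q : X' ⟶ X₁) (G : Type) [Group G] [Finite G]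
    (ρ : G →* Aut X') (hsep : IsSeparated f) (hft : LocallyOfFiniteType f) (hqc : QuasiCompact f)
    (hX₁ : IsIntegral X₁) (hX' : IsIntegral X') (hreg : Scheme.IsRegular X') (hq : IsFinite q)
    (hsurj : Function.Surjective q.base)
    (hU : ∃ U : X₁.Opens, Dense (U : Set X₁) ∧ Etale (q ∣_ U))
    (hρ : ∀ g : G, (ρ g).hom ≫ q = q)
    (horb : ∀ x y : X', q.base x = q.base y → ∃ g : G, (ρ g).hom.base x = y)
    (hNpS : ∀ x : X', HasNormalSylow p (inertiaSubgroup ρ x)) (hdimd : topologicalKrullDim X₁ ≤ d) :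
    Scheme.HasResolution X₁ := by
  haveI : Fact p.Prime := ⟨hp⟩
  -- (1) faithful WLOG
  wlog hfaith : Function.Injective ρ generalizing G
  · refine this (G ⧸ ρ.ker) (QuotientGroup.kerLift ρ) (fun g => ?_) (fun x y hxy => ?_)
      (fun x => hasNormalSylow_inertiaSubgroup_kerLift ρ x (hNpS x))
      (QuotientGroup.kerLift_injective ρ)
    · induction g using QuotientGroup.induction_on with
      | H g => rw [QuotientGroup.kerLift_mk]; exact hρ g
    · obtain ⟨g, hg⟩ := horb x y hxy
      exact ⟨(g : G ⧸ ρ.ker), by rw [QuotientGroup.kerLift_mk]; exact hg⟩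
  haveI := hsep; haveI := hft; haveI := hqc; haveI := hX'; haveI := hq; haveI := hX₁
  -- (2) dimension 0 apart
  by_cases hdim : topologicalKrullDim X₁ ≤ 0
  · exact (Scheme.IsRegular.of_topologicalKrullDim_le_zero hdim).hasResolution
  -- (3) the normal quotient of the identity model
  have hXnorm : ∀ x : X', IsIntegrallyClosed (X'.presheaf.stalk x) := fun x => by
    haveI := hreg x
    exact isIntegrallyClosed_of_isRegularLocalRing _
  obtain ⟨Y₁, g, qs, r, hsep₁, hft₁, hqc₁, hY₁, hnorm₁, -, hqsfin, hqssurj, hV, hinv₁, horb₁,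
      hr, -, hrg, W, hWd, hWfin, hWet, hWbij⟩ :=
    QuotientModelNormal.stub_quotientModelNormal p k X' X₁ f q G ρ hfaith hsurj hU hρ horb X' (𝟙 X')
      ρ ⟨⊤, by simp, by simp, inferInstance⟩ hXnorm (fun g => by simp)
      (PClosedCase.exists_isAffineOpen_stable q ρ hρ)
  haveI := hY₁; haveI := hr; haveI := hWfin; haveI := hWet; haveI := hft₁
  -- (4) lemma (L) and dimension bookkeeping
  have hbir₁ : IsBirational r := Birational.stub_birational_of_bijective k f r hdim W hWd hWbij
  haveI : LocallyOfFiniteType r := by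
    have : LocallyOfFiniteType (r ≫ f) := by rw [hrg]; infer_instance
    exact locallyOfFiniteType_of_comp r f
  have hdimeq : topologicalKrullDim Y₁ = topologicalKrullDim X₁ :=
    GluedSplitDim.topologicalKrullDim_eq_of_isBirational f r hbir₁
  have hdim₁ : ¬ topologicalKrullDim Y₁ ≤ 0 := by rwa [hdimeq]
  have hdimd₁ : topologicalKrullDim Y₁ ≤ d := by rwa [hdimeq]
  -- (5) resolve the quotient and descend
  exact ComponentGluing.Scheme.HasResolution.of_isBirational r hbir₁
    (hWQn p hp k X' Y₁ g qs G ρ hfaith hsep₁ hft₁ hqc₁ hY₁ hnorm₁ hdim₁ hX' hreg hqsfin hqssurj hV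
      hinv₁ horb₁ hNpS hdimd₁)


/-! ## PClosedWQNormal ⇒ PClosedWQ -/

/-- **The sharpened p-closed sub-problem implies the registered v4 one.** If PClosedWQNormal
holds (hypothesis `hWQn`: the v5 signature of `stub_pClosedWQNormal`, verbatim) then PClosedWQ
holds (conclusion: the v4 signature of `stub_pClosedWQ`, binders verbatim): replace `G` by its
faithful image (`hasNormalSylow_inertiaSubgroup_kerLift`), dispose of dimension `0` (regular),
form the NORMAL quotient `Y₁ = X′/G → X₁` by `QuotientModelNormal.stub_quotientModelNormal` fed
with the identity model (`X♯ = X′`; regular local rings are integrally closed; the `G`-stable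
affine cover is `PClosedCase.exists_isAffineOpen_stable`), which is birational by lemma (L) and of
the same positive dimension; the inertia groups upstairs are unchanged, so `hWQn` resolves `Y₁`
and the resolution descends along `Y₁ → X₁`. [folklore] -/
theorem pClosedWQ_of_pClosedWQNormal
    (hWQn : ∀ (p : ℕ) (_ : p.Prime) (k : Type) [Field k] [CharP k p] (X' X₁ : Scheme.{0})
      (f : X₁ ⟶ Spec (.of k)) (q : X' ⟶ X₁) (G : Type) [Group G] [Finite G] (ρ : G →* Aut X'),
      Function.Injective ρ → IsSeparated f → LocallyOfFiniteType f → QuasiCompact f →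
      IsIntegral X₁ → (∀ x : X₁, IsIntegrallyClosed (X₁.presheaf.stalk x)) →
      ¬ topologicalKrullDim X₁ ≤ 0 → IsIntegral X' → Scheme.IsRegular X' → IsFinite q →
      Function.Surjective q.base → (∃ U : X₁.Opens, Dense (U : Set X₁) ∧ Etale (q ∣_ U)) →
      (∀ g : G, (ρ g).hom ≫ q = q) →
      (∀ x y : X', q.base x = q.base y → ∃ g : G, (ρ g).hom.base x = y) →
      (∀ x : X', HasNormalSylow p (inertiaSubgroup ρ x)) → Scheme.HasResolution X₁)
    (p : ℕ) (hp : p.Prime) (k : Type) [Field k] [CharP k p]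
    (X' X₁ : Scheme.{0}) (f : X₁ ⟶ Spec (.of k)) (q : X' ⟶ X₁) (G : Type) [Group G] [Finite G]
    (ρ : G →* Aut X') (hsep : IsSeparated f) (hft : LocallyOfFiniteType f) (hqc : QuasiCompact f)
    (hX₁ : IsIntegral X₁) (hX' : IsIntegral X') (hreg : Scheme.IsRegular X') (hq : IsFinite q)
    (hsurj : Function.Surjective q.base)
    (hU : ∃ U : X₁.Opens, Dense (U : Set X₁) ∧ Etale (q ∣_ U))
    (hρ : ∀ g : G, (ρ g).hom ≫ q = q)
    (horb : ∀ x y : X', q.base x = q.base y → ∃ g : G, (ρ g).hom.base x = y)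
    (hNpS : ∀ x : X', HasNormalSylow p (inertiaSubgroup ρ x)) :
    Scheme.HasResolution X₁ :=
  pClosedWQ_dimLE_of_pClosedWQNormal_dimLE ⊤
    (fun p hp k _ _ X' X₁ f q G _ _ ρ hfaith hsep hft hqc hX₁ hnorm hdim hX' hreg hq hsurj hU hρ horb
        hNpS _ =>
      hWQn p hp k X' X₁ f q G ρ hfaith hsep hft hqc hX₁ hnorm hdim hX' hreg hq hsurj hU hρ horb hNpS)
    p hp k X' X₁ f q G ρ hsep hft hqc hX₁ hX' hreg hq hsurj hU hρ horb hNpS le_top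

/-- **The converse is free**: PClosedWQ (hypothesis `hWQp`, v4 registered signature verbatim)
implies PClosedWQNormal (conclusion: v5 signature of `stub_pClosedWQNormal`, binders verbatim) by
forgetting faithfulness, normality and positive dimension. [folklore] -/
theorem pClosedWQNormal_of_pClosedWQ
    (hWQp : ∀ (p : ℕ) (_ : p.Prime) (k : Type) [Field k] [CharP k p] (X' X₁ : Scheme.{0})
      (f : X₁ ⟶ Spec (.of k)) (q : X' ⟶ X₁) (G : Type) [Group G] [Finite G] (ρ : G →* Aut X'),
      IsSeparated f → LocallyOfFiniteType f → QuasiCompact f → IsIntegral X₁ → IsIntegral X' →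
      Scheme.IsRegular X' → IsFinite q → Function.Surjective q.base →
      (∃ U : X₁.Opens, Dense (U : Set X₁) ∧ Etale (q ∣_ U)) → (∀ g : G, (ρ g).hom ≫ q = q) →
      (∀ x y : X', q.base x = q.base y → ∃ g : G, (ρ g).hom.base x = y) →
      (∀ x : X', HasNormalSylow p (inertiaSubgroup ρ x)) → Scheme.HasResolution X₁)
    (p : ℕ) (hp : p.Prime) (k : Type) [Field k] [CharP k p]
    (X' X₁ : Scheme.{0}) (f : X₁ ⟶ Spec (.of k)) (q : X' ⟶ X₁) (G : Type) [Group G] [Finite G]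
    (ρ : G →* Aut X') (_hfaith : Function.Injective ρ) (hsep : IsSeparated f)
    (hft : LocallyOfFiniteType f) (hqc : QuasiCompact f) (hX₁ : IsIntegral X₁)
    (_hnorm : ∀ x : X₁, IsIntegrallyClosed (X₁.presheaf.stalk x))
    (_hdim : ¬ topologicalKrullDim X₁ ≤ 0) (hX' : IsIntegral X')
    (hreg : Scheme.IsRegular X') (hq : IsFinite q) (hsurj : Function.Surjective q.base)
    (hU : ∃ U : X₁.Opens, Dense (U : Set X₁) ∧ Etale (q ∣_ U))
    (hρ : ∀ g : G, (ρ g).hom ≫ q = q)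
    (horb : ∀ x y : X', q.base x = q.base y → ∃ g : G, (ρ g).hom.base x = y)
    (hNpS : ∀ x : X', HasNormalSylow p (inertiaSubgroup ρ x)) :
    Scheme.HasResolution X₁ :=
  hWQp p hp k X' X₁ f q G ρ hsep hft hqc hX₁ hX' hreg hq hsurj hU hρ horb hNpS

/-- **PClosedWQNormal ⇔ PClosedWQ** (both universally closed): the v5 sharpening of the p-closed
sub-problem is equivalent to the v4 registered one, so the Lean certificates
`PClosedCase.cyclicWildQuotient_of_pClosedWQ` (⊇ stmt-15644), `…tameQuotientResolution_of_pClosedWQ`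
(⊇ stmt-15645 over every field) and `…pClosedWQ_of_resolutionOfSingularities` (≤ summit) apply
to PClosedWQNormal unchanged. [folklore] -/
theorem pClosedWQNormal_iff_pClosedWQ :
    (∀ (p : ℕ) (_ : p.Prime) (k : Type) [Field k] [CharP k p] (X' X₁ : Scheme.{0})
      (f : X₁ ⟶ Spec (.of k)) (q : X' ⟶ X₁) (G : Type) [Group G] [Finite G] (ρ : G →* Aut X'),
      Function.Injective ρ → IsSeparated f → LocallyOfFiniteType f → QuasiCompact f →
      IsIntegral X₁ → (∀ x : X₁, IsIntegrallyClosed (X₁.presheaf.stalk x)) →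
      ¬ topologicalKrullDim X₁ ≤ 0 → IsIntegral X' → Scheme.IsRegular X' → IsFinite q →
      Function.Surjective q.base → (∃ U : X₁.Opens, Dense (U : Set X₁) ∧ Etale (q ∣_ U)) →
      (∀ g : G, (ρ g).hom ≫ q = q) →
      (∀ x y : X', q.base x = q.base y → ∃ g : G, (ρ g).hom.base x = y) →
      (∀ x : X', HasNormalSylow p (inertiaSubgroup ρ x)) → Scheme.HasResolution X₁) ↔
    (∀ (p : ℕ) (_ : p.Prime) (k : Type) [Field k] [CharP k p] (X' X₁ : Scheme.{0})
      (f : X₁ ⟶ Spec (.of k)) (q : X' ⟶ X₁) (G : Type) [Group G] [Finite G] (ρ : G →* Aut X'),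
      IsSeparated f → LocallyOfFiniteType f → QuasiCompact f → IsIntegral X₁ → IsIntegral X' →
      Scheme.IsRegular X' → IsFinite q → Function.Surjective q.base →
      (∃ U : X₁.Opens, Dense (U : Set X₁) ∧ Etale (q ∣_ U)) → (∀ g : G, (ρ g).hom ≫ q = q) →
      (∀ x y : X', q.base x = q.base y → ∃ g : G, (ρ g).hom.base x = y) →
      (∀ x : X', HasNormalSylow p (inertiaSubgroup ρ x)) → Scheme.HasResolution X₁) :=
  ⟨fun h p hp k _ _ X' X₁ f q G _ _ ρ => pClosedWQ_of_pClosedWQNormal h p hp k X' X₁ f q G ρ,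
    fun h p hp k _ _ X' X₁ f q G _ _ ρ => pClosedWQNormal_of_pClosedWQ h p hp k X' X₁ f q G ρ⟩

/-! ## The v5 composition: WQ ⇐ PhaseZeroModel ∧ PClosedWQNormal -/

/-- **The glued split of skeleton v5, proved**: PhaseZeroModel (hypothesis `hP0`: the v5
signature of `stub_phaseZero` — faithful, no engine hypotheses — universally closed) and
PClosedWQNormal (hypothesis `hWQn`) imply the crux `WildQuotientResolution` BY NAME. Proof =
the composition `WildQuotientResolution_of` of `Cruxes/WildQuotientResolution/Lines/Sketch.lean`
v5: faithful WLOG (`Negative.wqFaithful_iff`), Phase 0, dimension `0` apart, the normal quotient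
`X♯/G → X₁` (`QuotientModelNormal.stub_quotientModelNormal`), lemma (L), dimension bookkeeping,
`hWQn` on `X♯/G`, descent along the proper birational `X♯/G → X₁`. [folklore] -/
theorem wildQuotientResolution_of_phaseZero_of_pClosedWQNormal
    (hP0 : ∀ (p : ℕ) (_ : p.Prime) (k : Type) [Field k] [CharP k p] (X' X₁ : Scheme.{0})
      (f : X₁ ⟶ Spec (.of k)) (q : X' ⟶ X₁) (G : Type) [Group G] [Finite G] (ρ : G →* Aut X'),
      Function.Injective ρ → IsSeparated f → LocallyOfFiniteType f → QuasiCompact f →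
      IsIntegral X' → Scheme.IsRegular X' → IsFinite q → (∀ g : G, (ρ g).hom ≫ q = q) →
      ∃ (Xs : Scheme.{0}) (π : Xs ⟶ X') (ρs : G →* Aut Xs), IsProper π ∧ IsBirational π ∧
        IsIntegral Xs ∧ Scheme.IsRegular Xs ∧ (∀ g : G, (ρs g).hom ≫ π = π ≫ (ρ g).hom) ∧
        (∀ x : Xs, HasNormalSylow p (inertiaSubgroup ρs x)) ∧
        ∀ x : Xs, ∃ U : Xs.Opens, IsAffineOpen U ∧ x ∈ U ∧ ∀ g : G, (ρs g).hom ⁻¹ᵁ U = U)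
    (hWQn : ∀ (p : ℕ) (_ : p.Prime) (k : Type) [Field k] [CharP k p] (X' X₁ : Scheme.{0})
      (f : X₁ ⟶ Spec (.of k)) (q : X' ⟶ X₁) (G : Type) [Group G] [Finite G] (ρ : G →* Aut X'),
      Function.Injective ρ → IsSeparated f → LocallyOfFiniteType f → QuasiCompact f →
      IsIntegral X₁ → (∀ x : X₁, IsIntegrallyClosed (X₁.presheaf.stalk x)) →
      ¬ topologicalKrullDim X₁ ≤ 0 → IsIntegral X' → Scheme.IsRegular X' → IsFinite q →
      Function.Surjective q.base → (∃ U : X₁.Opens, Dense (U : Set X₁) ∧ Etale (q ∣_ U)) →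
      (∀ g : G, (ρ g).hom ≫ q = q) →
      (∀ x y : X', q.base x = q.base y → ∃ g : G, (ρ g).hom.base x = y) →
      (∀ x : X', HasNormalSylow p (inertiaSubgroup ρ x)) → Scheme.HasResolution X₁) :
    WildQuotientResolution := by
  refine Negative.wqFaithful_iff.mp ?_
  intro p hp k _ _ X' X₁ f q G _ _ ρ hfaith hsep hft hqc hX₁ hX' hreg hq hsurj hU hρ horb
  haveI := hsep; haveI := hft; haveI := hqc; haveI := hX'; haveI := hq; haveI := hX₁
  obtain ⟨Xs, π, ρs, hπ, hbir, hXs, hXsreg, hequiv, hNpS, hcov⟩ :=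
    hP0 p hp k X' X₁ f q G ρ hfaith hsep hft hqc hX' hreg hq hρ
  haveI := hπ; haveI := hXs
  by_cases hdim : topologicalKrullDim X₁ ≤ 0
  · exact (Scheme.IsRegular.of_topologicalKrullDim_le_zero hdim).hasResolution
  have hXsnorm : ∀ x : Xs, IsIntegrallyClosed (Xs.presheaf.stalk x) := fun x => by
    haveI := hXsreg x
    exact isIntegrallyClosed_of_isRegularLocalRing _
  obtain ⟨Y₁, g, qs, r, hsep₁, hft₁, hqc₁, hY₁, hnorm₁, hfaith₁, hqsfin, hqssurj, hV, hinv₁, horb₁,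
      hr, -, hrg, W, hWd, hWfin, hWet, hWbij⟩ :=
    QuotientModelNormal.stub_quotientModelNormal p k X' X₁ f q G ρ hfaith hsurj hU hρ horb Xs π ρs
      hbir hXsnorm hequiv hcov
  haveI := hY₁; haveI := hr; haveI := hWfin; haveI := hWet; haveI := hft₁
  have hbir₁ : IsBirational r := Birational.stub_birational_of_bijective k f r hdim W hWd hWbij
  haveI : LocallyOfFiniteType r := by
    have : LocallyOfFiniteType (r ≫ f) := by rw [hrg]; infer_instance
    exact locallyOfFiniteType_of_comp r f
  have hdim₁ : ¬ topologicalKrullDim Y₁ ≤ 0 := by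
    rwa [GluedSplitDim.topologicalKrullDim_eq_of_isBirational f r hbir₁]
  exact ComponentGluing.Scheme.HasResolution.of_isBirational r hbir₁
    (hWQn p hp k Xs Y₁ g qs G ρs hfaith₁ hsep₁ hft₁ hqc₁ hY₁ hnorm₁ hdim₁ hXs hXsreg hqsfin hqssurj
      hV hinv₁ horb₁ hNpS)


/-- **The bounded glued split of skeleton v5, proved**: for every `d : WithBot ℕ∞`,
PhaseZeroModel for `dim X′ ≤ d` (hypothesis `hP0`, faithful, no engine hypotheses) and
PClosedWQNormal for `dim X₁ ≤ d` (hypothesis `hWQn`) imply the crux for all `X₁` with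
`dim X₁ ≤ d` — `GluedSplitDim.wildQuotientResolution_dimLE_of_phaseZero_of_pClosedWQ` fed with
`pClosedWQ_dimLE_of_pClosedWQNormal_dimLE`. So a planner may file the first open dimension
(`d = 4`) as a glued split with its glue already a theorem. [folklore] -/
theorem wildQuotientResolution_dimLE_of_phaseZero_of_pClosedWQNormal (d : WithBot ℕ∞)
    (hP0 : ∀ (p : ℕ) (_ : p.Prime) (k : Type) [Field k] [CharP k p] (X' X₁ : Scheme.{0})
      (f : X₁ ⟶ Spec (.of k)) (q : X' ⟶ X₁) (G : Type) [Group G] [Finite G] (ρ : G →* Aut X'),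
      Function.Injective ρ → IsSeparated f → LocallyOfFiniteType f → QuasiCompact f →
      IsIntegral X' → Scheme.IsRegular X' → IsFinite q → (∀ g : G, (ρ g).hom ≫ q = q) →
      topologicalKrullDim X' ≤ d →
      ∃ (Xs : Scheme.{0}) (π : Xs ⟶ X') (ρs : G →* Aut Xs), IsProper π ∧ IsBirational π ∧
        IsIntegral Xs ∧ Scheme.IsRegular Xs ∧ (∀ g : G, (ρs g).hom ≫ π = π ≫ (ρ g).hom) ∧
        (∀ x : Xs, HasNormalSylow p (inertiaSubgroup ρs x)) ∧
        ∀ x : Xs, ∃ U : Xs.Opens, IsAffineOpen U ∧ x ∈ U ∧ ∀ g : G, (ρs g).hom ⁻¹ᵁ U = U)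
    (hWQn : ∀ (p : ℕ) (_ : p.Prime) (k : Type) [Field k] [CharP k p] (X' X₁ : Scheme.{0})
      (f : X₁ ⟶ Spec (.of k)) (q : X' ⟶ X₁) (G : Type) [Group G] [Finite G] (ρ : G →* Aut X'),
      Function.Injective ρ → IsSeparated f → LocallyOfFiniteType f → QuasiCompact f →
      IsIntegral X₁ → (∀ x : X₁, IsIntegrallyClosed (X₁.presheaf.stalk x)) →
      ¬ topologicalKrullDim X₁ ≤ 0 → IsIntegral X' → Scheme.IsRegular X' → IsFinite q →
      Function.Surjective q.base → (∃ U : X₁.Opens, Dense (U : Set X₁) ∧ Etale (q ∣_ U)) →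
      (∀ g : G, (ρ g).hom ≫ q = q) →
      (∀ x y : X', q.base x = q.base y → ∃ g : G, (ρ g).hom.base x = y) →
      (∀ x : X', HasNormalSylow p (inertiaSubgroup ρ x)) → topologicalKrullDim X₁ ≤ d →
      Scheme.HasResolution X₁)
    (p : ℕ) (hp : p.Prime) (k : Type) [Field k] [CharP k p] (X' X₁ : Scheme.{0})
    (f : X₁ ⟶ Spec (.of k)) (q : X' ⟶ X₁) (G : Type) [Group G] [Finite G] (ρ : G →* Aut X')
    (hsep : IsSeparated f) (hft : LocallyOfFiniteType f) (hqc : QuasiCompact f)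
    (hX₁ : IsIntegral X₁) (hX' : IsIntegral X') (hreg : Scheme.IsRegular X') (hq : IsFinite q)
    (hsurj : Function.Surjective q.base)
    (hU : ∃ U : X₁.Opens, Dense (U : Set X₁) ∧ Etale (q ∣_ U))
    (hρ : ∀ g : G, (ρ g).hom ≫ q = q)
    (horb : ∀ x y : X', q.base x = q.base y → ∃ g : G, (ρ g).hom.base x = y)
    (hdim : topologicalKrullDim X₁ ≤ d) : Scheme.HasResolution X₁ :=
  GluedSplitDim.wildQuotientResolution_dimLE_of_phaseZero_of_pClosedWQ d hP0
    (fun p hp k _ _ X' X₁ f q G _ _ ρ hsep hft hqc hX₁ hX' hreg hq hsurj hU hρ horb hNpS hdimd =>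
      pClosedWQ_dimLE_of_pClosedWQNormal_dimLE d hWQn p hp k X' X₁ f q G ρ hsep hft hqc hX₁ hX'
        hreg hq hsurj hU hρ horb hNpS hdimd)
    p hp k X' X₁ f q G ρ hsep hft hqc hX₁ hX' hreg hq hsurj hU hρ horb hdim

end Summit.ResolutionOfSingularities.ResolutionOfSingularities.Theorems.WildQuotientResolution.GluedSplitNormal

end
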